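import Summits.FinalStateConjecture.FinalStateConjecture.Theorems.ClusterCompletenessAdiabaticMultiKerrILEDZoneDisjoint
import Summits.FinalStateConjecture.FinalStateConjecture.Theorems.ClusterCompletenessAdiabaticMultiKerrILEDPointwiseTerm
import Summits.FinalStateConjecture.FinalStateConjecture.Theorems.ClusterCompletenessAdiabaticMultiKerrILEDTermDerivBound

/-!
# Route ClusterCompleteness — crux `AdiabaticMultiKerrILED`, line `Sketch`: the patched field,
# pointwise

Helper file for the crux `stmt-FinalStateConjecture-14310`
(`Summit.FinalStateConjecture.FinalStateConjecture.Theses.ClusterCompleteness.AdiabaticMultiKerrILED`),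
closing the stub `stub_cruxFieldPointwise` of line `Sketch`.

The patched inverse metric of the crux is `G = η − Σᵢ χᵢ · 2Hᵢ(qᵢx) · (Λᵢℓ♯ᵢ(qᵢx)) ⊗ (Λᵢℓ♯ᵢ(qᵢx))`,
`χᵢ = smoothTransition (2 − rᵢ/8Mᵢ) ∈ [0, 1]` (`= 1` on `{rᵢ ≤ 8Mᵢ}`, `= 0` on `{16Mᵢ ≤ rᵢ}`). The
finite-time energy estimate (Grönwall) uses three pointwise facts about `G`, packaged here:

1. at lab points with `x⁰ ≥ 0` outside every horizon, `G = η − φ₀ l₀ ⊗ l₀` with `l₀` `η`-null and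
   normalised (`η(l₀, e₀) = 1`) and `0 ≤ φ₀ ≤ Φ` uniformly: by zone disjointness
   (`stub_zoneDisjoint`) at most one term is active, and that term is of this form
   (`stub_pointwiseTerm`), the cut-off `χᵢ ∈ [0, 1]` only rescaling `φ₀`; far from all holes
   `G = η` (`φ₀ = 0`, `l₀ = −e₀ + e₁`);
2. a uniform bound `D = ∑ᵢ Dᵢ` on all first coordinate derivatives of the components of `G` on the
   exterior (all times), from the one-term bound `stub_termDerivBound` and linearity of `fderiv`;
3. inside `{rᵢ ≤ 8Mᵢ}` (`x⁰ ≥ 0`) the cut-off of hole `i` is `1` and the others vanish, so `G` is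
   exactly the boosted Kerr field of hole `i`.

Special relativity / calculus folklore (O'Neill 1983, Ch. 9, pp. 233–236; Kerr–Schild 1965, §2;
Visser arXiv:0706.0622, (33)–(35)). [folklore]
-/

noncomputable section

-- the doubled `FinalStateConjecture.FinalStateConjecture` path component trips dupNamespace
set_option linter.dupNamespace false

open scoped InnerProductSpace
open Literature.Geometry.Lorentzian

namespace Summit.FinalStateConjecture.FinalStateConjecture.Cruxes.AdiabaticMultiKerrILED.Sketch

/-- The vector `−e₀ + e₁ = (−1, 1, 0, 0)` is `η`-null and normalised: `η(l, l) = 0`, `η(l, e₀) = 1`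
(O'Neill 1983, Ch. 3, p. 55). [folklore] -/
private theorem bilin_negBasisZero_add_basisOne :
    Minkowski.bilin (-E4.basisVector 0 + E4.basisVector 1) (-E4.basisVector 0 + E4.basisVector 1) = 0 ∧
      Minkowski.bilin (-E4.basisVector 0 + E4.basisVector 1) (E4.basisVector 0) = 1 := by
  constructor <;> simp [Fin.sum_univ_three, Fin.succ_ne_zero, E4.basisVector]

/-- `r₊(M, a) = M + √(M² − a²) > 0` for `M > 0` (Visser arXiv:0706.0622, (35)). [folklore] -/
private theorem rPlus_pos' {M : ℝ} (hM : 0 < M) (a : ℝ) : 0 < Kerr.rPlus M a := by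
  unfold Kerr.rPlus
  have := Real.sqrt_nonneg (M ^ 2 - a ^ 2)
  linarith

/-- **The patched field at slab points: pointwise generalised Kerr–Schild form, uniform derivative
bound, and exact boosted-Kerr form near each horizon.** From zone disjointness (`stub_zoneDisjoint`),
the normalised form of one term (`stub_pointwiseTerm`) and the one-term derivative bound
(`stub_termDerivBound`): at a lab point with `x⁰ ≥ 0` at most one term is active, `χᵢ ∈ [0, 1]`
only rescales `φ₀`, far from all holes `G = η` (`φ₀ = 0`, `l₀ = (−1, 1, 0, 0)`), `|∂G| ≤ ∑ᵢ Dᵢ`, and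
inside `{rᵢ ≤ 8Mᵢ}` the cut-off is `1`. [folklore] -/
theorem stub_cruxFieldPointwise :
    ∀ {N : ℕ} (M a : Fin N → ℝ) (Λ : Fin N → lorentzGroup) (p : Fin N → E3) (u : Fin N → E4)
      (q : Fin N → E4 → E4),
      (∀ i, u i = (Λ i : E4 ≃L[ℝ] E4) (E4.basisVector 0)) →
      (∀ i x, q i x = poincareInv (Λ i) (E4.ofTimeSpace 0 (p i)) x) →
      (∀ i, 0 < M i) → (∀ i, |a i| ≤ 2⁻¹ * M i) →
      (∀ i, 0 < u i 0 ∧ ‖E4.spatial (u i)‖ ≤ 2⁻¹ * u i 0) →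
      (∀ i j, i ≠ j → 40 * (M i + M j) ≤ dist (p i) (p j) ∧
        0 < ⟪p i - p j, (u i 0)⁻¹ • E4.spatial (u i) - (u j 0)⁻¹ • E4.spatial (u j)⟫_ℝ) →
      ∀ (G : E4 → Fin 4 → Fin 4 → ℝ),
      (∀ x μ ν, G x μ ν = Minkowski.bilin (E4.basisVector μ) (E4.basisVector ν) -
        ∑ i, Real.smoothTransition (2 - Kerr.radius (a i) (q i x) / (8 * M i)) *
          (2 * Kerr.scalarH (M i) (a i) (q i x)) *
          ((Λ i : E4 ≃L[ℝ] E4) (Kerr.nullVector (a i) (q i x))) μ *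
          ((Λ i : E4 ≃L[ℝ] E4) (Kerr.nullVector (a i) (q i x))) ν) →
      ∃ Φ D : ℝ, 0 ≤ Φ ∧ 0 ≤ D ∧
        (∀ x : E4, 0 ≤ x 0 → (∀ i, Kerr.rPlus (M i) (a i) < Kerr.radius (a i) (q i x)) →
          ∃ (φ₀ : ℝ) (l₀ : E4), 0 ≤ φ₀ ∧ φ₀ ≤ Φ ∧
            Minkowski.bilin l₀ l₀ = 0 ∧ Minkowski.bilin l₀ (E4.basisVector 0) = 1 ∧
            ∀ μ ν, G x μ ν = Kerr.etaComp μ ν - φ₀ * l₀ μ * l₀ ν) ∧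
        (∀ x : E4, (∀ i, Kerr.rPlus (M i) (a i) < Kerr.radius (a i) (q i x)) →
          ∀ μ α β : Fin 4, |fderiv ℝ (fun y ↦ G y α β) x (E4.basisVector μ)| ≤ D) ∧
        (∀ x : E4, 0 ≤ x 0 → ∀ i, Kerr.radius (a i) (q i x) ≤ 8 * M i →
          ∀ μ ν, G x μ ν = Minkowski.bilin (E4.basisVector μ) (E4.basisVector ν) -
            2 * Kerr.scalarH (M i) (a i) (q i x) * ((Λ i : E4 ≃L[ℝ] E4) (Kerr.nullVector (a i) (q i x))) μ *
              ((Λ i : E4 ≃L[ℝ] E4) (Kerr.nullVector (a i) (q i x))) ν) := by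
  intro N M a Λ p u q hu hq hM ha hv hsep G hG
  -- the one-term data: `Φᵢ` (normalised Kerr–Schild form) and `Dᵢ` (derivative bound)
  have hPT := fun i ↦ stub_pointwiseTerm (M i) (a i) (Λ i) (u i) (hu i) (hM i) (ha i) (hv i).1
  choose Φi hΦi0 hΦi using hPT
  have hTD := fun i ↦ stub_termDerivBound (M i) (a i) (Λ i) (p i) (q i) (hq i) (hM i) (ha i)
  choose Di hDi0 hDi using hTD
  -- zone disjointness: if hole `i` is within `17 Mᵢ`, every other cut-off vanishes
  have hoff : ∀ x : E4, 0 ≤ x 0 → ∀ i, Kerr.radius (a i) (q i x) ≤ 17 * M i → ∀ j, j ≠ i →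
      Real.smoothTransition (2 - Kerr.radius (a j) (q j x) / (8 * M j)) = 0 := by
    intro x hx0 i hi j hji
    have h17 : 17 * M j < Kerr.radius (a j) (q j x) :=
      stub_zoneDisjoint M a Λ p u q hu hq hM ha hv hsep x hx0 i j (Ne.symm hji) hi
    exact Theorems.cruxCutoff_eq_zero (hM j) (by linarith [hM j])
  refine ⟨∑ i, Φi i, ∑ i, Di i, Finset.sum_nonneg fun i _ ↦ hΦi0 i,
    Finset.sum_nonneg fun i _ ↦ hDi0 i, ?_, ?_, ?_⟩
  · -- (1) pointwise generalised Kerr–Schild form on the exterior, `x⁰ ≥ 0`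
    intro x hx0 hext
    by_cases h : ∃ i, Kerr.radius (a i) (q i x) ≤ 16 * M i
    · obtain ⟨i, hi⟩ := h
      have hi17 : Kerr.radius (a i) (q i x) ≤ 17 * M i := by linarith [hM i]
      obtain ⟨φ₀, l₀, hφ0, hφΦ, hll, hl0, hform⟩ := hΦi i (q i x) (hext i)
      set χ : ℝ := Real.smoothTransition (2 - Kerr.radius (a i) (q i x) / (8 * M i)) with hχ
      have hχ0 : 0 ≤ χ := Real.smoothTransition.nonneg _
      have hχ1 : χ ≤ 1 := Real.smoothTransition.le_one _
      refine ⟨χ * φ₀, l₀, mul_nonneg hχ0 hφ0, ?_, hll, hl0, fun μ ν ↦ ?_⟩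
      · calc χ * φ₀ ≤ 1 * φ₀ := mul_le_mul_of_nonneg_right hχ1 hφ0
          _ = φ₀ := one_mul _
          _ ≤ Φi i := hφΦ
          _ ≤ ∑ j, Φi j :=
            Finset.single_le_sum (f := Φi) (fun j _ ↦ hΦi0 j) (Finset.mem_univ i)
      · rw [hG, Kerr.minkowski_bilin_basisVector, Finset.sum_eq_single i]
        · have e := hform μ ν
          calc Kerr.etaComp μ ν - χ * (2 * Kerr.scalarH (M i) (a i) (q i x)) *
                ((Λ i : E4 ≃L[ℝ] E4) (Kerr.nullVector (a i) (q i x))) μ *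
                ((Λ i : E4 ≃L[ℝ] E4) (Kerr.nullVector (a i) (q i x))) ν
              = Kerr.etaComp μ ν - χ * (2 * Kerr.scalarH (M i) (a i) (q i x) *
                ((Λ i : E4 ≃L[ℝ] E4) (Kerr.nullVector (a i) (q i x))) μ *
                ((Λ i : E4 ≃L[ℝ] E4) (Kerr.nullVector (a i) (q i x))) ν) := by ring
            _ = Kerr.etaComp μ ν - χ * (φ₀ * l₀ μ * l₀ ν) := by rw [e]
            _ = Kerr.etaComp μ ν - χ * φ₀ * l₀ μ * l₀ ν := by ring
        · intro j _ hji
          rw [hoff x hx0 i hi17 j hji]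
          ring
        · intro hni
          exact absurd (Finset.mem_univ i) hni
    · push Not at h
      refine ⟨0, -E4.basisVector 0 + E4.basisVector 1, le_rfl, Finset.sum_nonneg fun i _ ↦ hΦi0 i,
        bilin_negBasisZero_add_basisOne.1, bilin_negBasisZero_add_basisOne.2, fun μ ν ↦ ?_⟩
      rw [Theorems.cruxField_eq_etaComp_of_far hG hM (fun i ↦ (h i).le)]
      ring
  · -- (2) uniform derivative bound on the exterior (all times)
    intro x hext μ α β
    set T : Fin N → E4 → ℝ := fun i y ↦
      Real.smoothTransition (2 - Kerr.radius (a i) (q i y) / (8 * M i)) *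
        (2 * Kerr.scalarH (M i) (a i) (q i y)) *
        ((Λ i : E4 ≃L[ℝ] E4) (Kerr.nullVector (a i) (q i y))) α *
        ((Λ i : E4 ≃L[ℝ] E4) (Kerr.nullVector (a i) (q i y))) β with hT
    have hfun : (fun y ↦ G y α β) =
        fun y ↦ Minkowski.bilin (E4.basisVector α) (E4.basisVector β) - ∑ i, T i y := by
      funext y
      rw [hG]
    -- each term is differentiable at `x` (all rest-frame radii are positive there)
    have hTd : ∀ i, DifferentiableAt ℝ (T i) x := by
      intro i
      have hxi : 0 < Kerr.radius (a i) (poincareInv (Λ i) (E4.ofTimeSpace 0 (p i)) x) := by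
        rw [← hq]
        exact Theorems.radius_pos_of_rPlus_lt (hM i) (hext i)
      have hc := (Theorems.contDiffAt_cruxTerm (M i) (a i) (Λ i) (E4.ofTimeSpace 0 (p i)) hxi α β
        (n := 1)).differentiableAt one_ne_zero
      have hTi : T i = fun y ↦
          Real.smoothTransition (2 - Kerr.radius (a i) (poincareInv (Λ i)
              (E4.ofTimeSpace 0 (p i)) y) / (8 * M i)) *
            (2 * Kerr.scalarH (M i) (a i) (poincareInv (Λ i) (E4.ofTimeSpace 0 (p i)) y)) *
            ((Λ i : E4 ≃L[ℝ] E4) (Kerr.nullVector (a i)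
              (poincareInv (Λ i) (E4.ofTimeSpace 0 (p i)) y))) α *
            ((Λ i : E4 ≃L[ℝ] E4) (Kerr.nullVector (a i)
              (poincareInv (Λ i) (E4.ofTimeSpace 0 (p i)) y))) β := by
        funext y
        simp only [hT, hq]
      rw [hTi]
      exact hc
    -- the one-term bounds apply: `r₊/2 < r₊ < rᵢ`
    have hTb : ∀ i, |fderiv ℝ (T i) x (E4.basisVector μ)| ≤ Di i := by
      intro i
      have h2 : 2⁻¹ * Kerr.rPlus (M i) (a i) < Kerr.radius (a i) (q i x) := by
        have hrp := rPlus_pos' (hM i) (a i)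
        linarith [hext i]
      exact hDi i x h2 μ α β
    -- linearity of the derivative
    have hderiv : HasFDerivAt (fun y ↦ G y α β) (-(∑ i, fderiv ℝ (T i) x)) x := by
      rw [hfun]
      exact (HasFDerivAt.fun_sum fun i _ ↦ (hTd i).hasFDerivAt).const_sub _
    rw [hderiv.fderiv, neg_apply, sum_apply, abs_neg]
    calc |∑ i, fderiv ℝ (T i) x (E4.basisVector μ)|
        ≤ ∑ i, |fderiv ℝ (T i) x (E4.basisVector μ)| := Finset.abs_sum_le_sum_abs _ _
      _ ≤ ∑ i, Di i := Finset.sum_le_sum fun i _ ↦ hTb i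
  · -- (3) exact boosted Kerr inside `{rᵢ ≤ 8Mᵢ}`, `x⁰ ≥ 0`
    intro x hx0 i h8 μ ν
    have hi17 : Kerr.radius (a i) (q i x) ≤ 17 * M i := by linarith [hM i]
    rw [hG, Finset.sum_eq_single i]
    · rw [Theorems.cruxCutoff_eq_one (hM i) h8]
      ring
    · intro j _ hji
      rw [hoff x hx0 i hi17 j hji]
      ring
    · intro hni
      exact absurd (Finset.mem_univ i) hni

end Summit.FinalStateConjecture.FinalStateConjecture.Cruxes.AdiabaticMultiKerrILED.Sketch

end
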